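import Literature.NumberTheory.EllipticCurves.BurungaleKobayashiNakamuraOta2026.LocalBottomIndex
import Literature.NumberTheory.EllipticCurves.BurungaleKobayashiNakamuraOta2026.PadicEndSpan
import HarnessLib

/-!
# Compact Kummer descent: the `E(L) ⊗ ℤ_p` half of `0 → E(L) ⊗ ℤ_p → S_p(E/L) → T_pШ(E/L) → 0`

Topic `NumberTheory/EllipticCurves` (named for the RESULT). Generic: any field `K`, any subgroup
`H ≤ Γ_K` (`L = K̄^H`), any prime `p`; nothing about a particular curve is asserted, no published theorem
is restated as a fact — everything below is PROVED (folklore around Silverman *AEC* VIII.§2 / X.§4,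
Perrin-Riou 1987 §0, Howard 2004 §1). Namespace `WeierstrassCurve`.
* Part 1. `torsionToGeomH1Over m H : H¹(H, E[m]) → H¹(H, E(K̄))` (the `H`-level twin of the tree's
  `torsionH1ToH1`, file `Selmer`); EXACTNESS of the Kummer sequence at `H¹(H, E[m])` — the kernel is
  exactly the Kummer classes `kummerClassOver` (`torsionToGeomH1Over_kummerClassOver`,
  `exists_kummerClassOver_eq_of_torsionToGeomH1Over_eq_zero`); `p_*`-compatibility
  (`torsionToGeomH1Over_reduceTorsionH1`: `p_*` becomes multiplication by `p`), iterated along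
  compatible families (`torsionToGeomH1Over_apply_eq_pow_smul_of_mem_compatiblePi`).
* Part 2. A compatible family `x ∈ ∏_k H¹(H, E[p^k])` whose images in `H¹(H, E(K̄))` are killed by one
  power `p^e` (what a user gets from «`Ш(E/L)[p^∞]` has exponent `p^e`» when the `x_k` are Selmer
  classes) is LEVELWISE KUMMER: `x_k = δ_k(P_k)`, `P_k ∈ E(L)`
  (`exists_kummerFamily_apply_eq_of_pow_smul_eq_zero`) — the vanishing of `S_p(E/L) → T_pШ(E/L)`.
* Part 3. If `E(L)` is generated modulo torsion by `g_1, …, g_r`, independent modulo torsion, and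
  `E(L)[p] = 0`, such an `x` lies in the `ℤ_p`-span of the Kummer families of the `g_i` (`kummerSpan`),
  hence in `mordellWeilKummerSpan = E(L) ⊗ ℤ_p`
  (`mem_mordellWeilKummerSpan_of_pow_smul_torsionToGeomH1Over_eq_zero`); the `p`-adic coordinates
  come from the levelwise integer coordinates (compatible by Kummer injectivity
  `kummerFamily_apply_eq_zero_iff`) through Mathlib's `PadicInt.lift` on the evaluations `ℤ[X] → ℤ/p^k`.

Written as the generic «(S_sat-MW)» brick of the cell `bsd-cm` K7r line `rubin-formula-zp` (stub
`RamifiedCMBottomSaturationAt`: `S_{p,rel}(E/K) ≤ E(K) ⊗ ℤ_p`), seat `bsd-cm-k8i-c2` g8; route-independent,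
imports no `Summits` module. NOT here: finiteness of `[S_{p,rel} : S_p]` (global duality), the passage
from the tree's `WeierstrassCurve.sha` of a base change to the hypothesis of Part 2, Mordell–Weil.

References: B. Perrin-Riou, Bull. SMF 115 (1987), §0 pp. 401–402 (`S_p(L)`, `E(L) ⊗ ℤ_p ↪ S_p(L)`);
B. Howard, Compositio 140 (2004), §1 (`0 → E(L) ⊗ ℤ_p → S_p(E/L) → lim← Ш_{p^n} → 0`);
J. H. Silverman, *AEC* (2009), VIII.§2 (Kummer sequence), X.§4 (Selmer and `Ш`).
-/

noncomputable section

open scoped Classical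

open Literature.NumberTheory.EllipticCurves Literature.NumberTheory.GaloisRepresentations

universe u

namespace WeierstrassCurve

variable {K : Type u} [Field K] (W : WeierstrassCurve K)

/-! ## Part 1. `H¹(H, E[m]) → H¹(H, E(K̄))`: definition, kernel = Kummer classes, `p_*`-compatibility -/

section ToGeom

variable (m : ℤ) (H : Subgroup (Field.absoluteGaloisGroup K))

/-- **`H¹(H, E[m]) → H¹(H, E(K̄))`** over `L = K̄^H`, induced by `E[m] ↪ E(K̄)` (pair `(id_H, incl)`): the
`H`-level twin of the tree's `torsionH1ToH1`. Kernel = `E(L)/mE(L)` (Kummer), image = `H¹(L, E)[m]`; on Selmer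
classes it is `Sel^{(m)}(E/L) → Ш(E/L)[m]`. [cite: SilvermanAEC2009, VIII.§2 and X.§4 (the Kummer sequence)] -/
def torsionToGeomH1Over :
    W.torsionH1Over m H →+ Literature.NumberTheory.EllipticCurves.subgroupH1 H (geomPoints W) :=
  resH1Hom (ContinuousMonoidHom.id H) (geomTorsion W m).subtype fun _ _ ↦ rfl

/-- `torsionToGeomH1Over` on an explicit cocycle: `[φ] ↦ [σ ↦ (φ σ : E(K̄))]`.
[cite: SilvermanAEC2009, VIII.§2 (the Kummer sequence)] -/
theorem torsionToGeomH1Over_oneCocycleClass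
    (φ : contOneCocycles (discreteTopRep H (geomTorsion W m))) :
    W.torsionToGeomH1Over m H (oneCocycleClass _ φ) =
      oneCocycleClass _ (contOneCocycles.push (geomTorsion W m).subtype (fun _ _ ↦ rfl) φ) :=
  resH1Hom_id_oneCocycleClass _ _ φ

/-- **Kummer classes die in `H¹(H, E(K̄))`**: `torsionToGeomH1Over (δ(m • Q)) = 0` (the cocycle
`σ ↦ σQ − Q` is the coboundary of `Q` in `E(K̄)`). [cite: SilvermanAEC2009, VIII.§2 (the Kummer sequence)] -/
theorem torsionToGeomH1Over_kummerClassOver (Q : geomPoints W) (hQ : ∀ σ ∈ H, σ • (m • Q) = m • Q) :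
    W.torsionToGeomH1Over m H (W.kummerClassOver H m Q hQ) = 0 := by
  rw [kummerClassOver, torsionToGeomH1Over_oneCocycleClass, oneCocycleClass_eq_zero_iff]
  exact ⟨Q, fun σ ↦ rfl⟩

/-- **Exactness of the Kummer sequence at `H¹(H, E[m])`**: a class of `H¹(H, E[m])` that dies in
`H¹(H, E(K̄))` is a Kummer class `δ(m • Q) = [σ ↦ σQ − Q]` for some `Q ∈ E(K̄)` with `m • Q ∈ E(L)` (a
trivialising `Q` for the pushed-forward cocycle has `m • Q` fixed by `H` because the cocycle is
`m`-torsion-valued). Silverman, *AEC*, VIII.§2 / X.§4 (`ker(H¹(K, E[m]) → H¹(K, E)) = E(K)/mE(K)`).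
[cite: SilvermanAEC2009, VIII.§2 and X.§4 (the Kummer sequence)] -/
theorem exists_kummerClassOver_eq_of_torsionToGeomH1Over_eq_zero (x : W.torsionH1Over m H)
    (hx : W.torsionToGeomH1Over m H x = 0) :
    ∃ (Q : geomPoints W) (hQ : ∀ σ ∈ H, σ • (m • Q) = m • Q), x = W.kummerClassOver H m Q hQ := by
  obtain ⟨φ, rfl⟩ := oneCocycleClass_surjective _ x
  rw [torsionToGeomH1Over_oneCocycleClass, oneCocycleClass_eq_zero_iff] at hx
  obtain ⟨Q, hQφ⟩ := hx
  have hval : ∀ σ : H, ((φ.1 σ : geomTorsion W m) : geomPoints W) =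
      (σ : Field.absoluteGaloisGroup K) • Q - Q := fun σ ↦ hQφ σ
  have hQ : ∀ σ ∈ H, σ • (m • Q) = m • Q := fun σ hσ ↦ by
    have h := (mem_geomTorsion_iff W m _).1 (φ.1 ⟨σ, hσ⟩).2
    rw [hval ⟨σ, hσ⟩, zsmul_sub, sub_eq_zero, ← smul_zsmul_geomPoints] at h
    exact h
  refine ⟨Q, hQ, congrArg (oneCocycleClass _) (Subtype.ext (ContinuousMap.ext fun σ ↦ Subtype.ext ?_))⟩
  rw [hval σ, coe_kummerCocycleOver_apply]
  rfl

/-- The component `x_k ∈ H¹(H, E[p^k])` of a family is `p^k`-torsion (it is represented by a cocycle with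
values in `E[p^k]`). [cite: SilvermanAEC2009, VIII.§2 (cohomology of the finite module `E[m]`)] -/
theorem pow_smul_torsionH1Over_eq_zero (p k : ℕ) (y : W.torsionH1Over ((p : ℤ) ^ k) H) :
    ((p : ℤ) ^ k) • y = 0 := by
  obtain ⟨φ, rfl⟩ := oneCocycleClass_surjective (discreteTopRep H (geomTorsion W ((p : ℤ) ^ k))) y
  have h := nsmul_oneCocycleClass_eq_zero φ (p ^ k) fun g ↦ Subtype.ext (by
    rw [AddSubmonoidClass.coe_nsmul, ← natCast_zsmul, Nat.cast_pow]
    exact (mem_geomTorsion_iff W _ _).1 (φ.1 g).2)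
  rwa [← natCast_zsmul, Nat.cast_pow] at h

end ToGeom

section Reduce

variable (p : ℕ) (H : Subgroup (Field.absoluteGaloisGroup K))

/-- **`p_*`-compatibility**: under `H¹(H, E[·]) → H¹(H, E(K̄))` the transition map
`p_* : H¹(H, E[p^{k+1}]) → H¹(H, E[p^k])` (`reduceTorsionH1`, induced by `P ↦ p • P`) becomes
multiplication by `p`: `ι_k (p_* x) = p • ι_{k+1} x` (both are the class of `σ ↦ p • φ(σ)` in `E(K̄)`).
Perrin-Riou 1987, §0 (the transition maps of `S_p(L)`); Silverman, *AEC*, VIII.§2.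
[cite: PerrinRiou1987BSMF, §0 p. 401 (transition maps induced by multiplication by `p`)] -/
theorem torsionToGeomH1Over_reduceTorsionH1 (k : ℕ) (x : W.torsionH1Over ((p : ℤ) ^ (k + 1)) H) :
    W.torsionToGeomH1Over ((p : ℤ) ^ k) H (W.reduceTorsionH1 p k H x) =
      p • W.torsionToGeomH1Over ((p : ℤ) ^ (k + 1)) H x := by
  obtain ⟨φ, rfl⟩ := oneCocycleClass_surjective _ x
  have hred : W.reduceTorsionH1 p k H (oneCocycleClass _ φ) =
      oneCocycleClass _ (contOneCocycles.push (G := H) (W.geomTorsionReduce p k) (fun τ P ↦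
        Subtype.ext (by
          change (p : ℤ) • ((τ : Field.absoluteGaloisGroup K) • (P : geomPoints W)) =
            (τ : Field.absoluteGaloisGroup K) • ((p : ℤ) • (P : geomPoints W))
          rw [smul_zsmul_geomPoints])) φ) :=
    resH1Hom_id_oneCocycleClass _ _ φ
  have hsm := oneCocycleClass_smul (discreteTopRep H (geomPoints W)) (p : ℤ)
    (contOneCocycles.push (geomTorsion W ((p : ℤ) ^ (k + 1))).subtype (fun _ _ ↦ rfl) φ)
  conv at hsm => rhs; rw [Nat.cast_smul_eq_nsmul]
  rw [hred, torsionToGeomH1Over_oneCocycleClass, torsionToGeomH1Over_oneCocycleClass, ← hsm]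
  refine congrArg (oneCocycleClass _) (Subtype.ext (ContinuousMap.ext fun σ ↦ ?_))
  rw [contOneCocycles.push_apply, contOneCocycles.push_apply, Submodule.coe_smul,
    ContinuousMap.smul_apply, contOneCocycles.push_apply]
  rfl

/-- **Iterated `p_*`-compatibility along a compatible family**: for `x ∈ compatiblePi` (every
`x_k = p_* x_{k+1}`), `ι_k(x_k) = p^j • ι_{k+j}(x_{k+j})` in `H¹(H, E(K̄))` for all `k, j`.
[cite: PerrinRiou1987BSMF, §0 p. 401 (transition maps induced by multiplication by `p`)] -/
theorem torsionToGeomH1Over_apply_eq_pow_smul_of_mem_compatiblePi {x : W.torsionH1Pi p H}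
    (hx : x ∈ W.compatiblePi H p) (k j : ℕ) :
    W.torsionToGeomH1Over ((p : ℤ) ^ k) H (x k) =
      (p ^ j) • W.torsionToGeomH1Over ((p : ℤ) ^ (k + j)) H (x (k + j)) := by
  induction j with
  | zero => simp
  | succ j ih =>
    rw [ih, ← (W.mem_compatiblePi_iff.1 hx) (k + j), torsionToGeomH1Over_reduceTorsionH1, smul_smul,
      ← pow_succ, ← add_assoc]

end Reduce

/-! ## Part 2. Bounded `Ш`-image ⟹ every component of a compatible family is a Kummer class -/

section Levelwise

variable (p : ℕ) (H : Subgroup (Field.absoluteGaloisGroup K))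

/-- **`T_pШ = 0` in compact currency.** If `x ∈ ∏_k H¹(H, E[p^k])` is compatible and its images in
`H¹(H, E(K̄))` are all killed by one power `p^e` (for SELMER families: the part of `Ш(E/L)[p^∞]` they sweep
out has exponent `p^e`, e.g. `Ш(E/L)[p^∞]` finite), then every component dies in `H¹(H, E(K̄))`
(`ι_k(x_k) = p^e • ι_{k+e}(x_{k+e}) = 0`). [cite: Howard2004HeegnerKolyvagin, §1 (descent sequence for S_p(E/L))] -/
theorem torsionToGeomH1Over_apply_eq_zero_of_pow_smul_eq_zero {x : W.torsionH1Pi p H}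
    (hx : x ∈ W.compatiblePi H p) (e : ℕ)
    (hSha : ∀ k, (p ^ e) • W.torsionToGeomH1Over ((p : ℤ) ^ k) H (x k) = 0) (k : ℕ) :
    W.torsionToGeomH1Over ((p : ℤ) ^ k) H (x k) = 0 := by
  rw [W.torsionToGeomH1Over_apply_eq_pow_smul_of_mem_compatiblePi p H hx k e, hSha (k + e)]

/-- **Every component of such a family is the Kummer class of an `L`-rational point**:
`x_k = (kummerFamily P_k)_k = δ_k(P_k)`, `P_k ∈ E(L)`. [cite: Howard2004HeegnerKolyvagin, §1 (descent sequence for S_p(E/L))] -/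
theorem exists_kummerFamily_apply_eq_of_pow_smul_eq_zero [Fact p.Prime] [W.IsElliptic]
    {x : W.torsionH1Pi p H} (hx : x ∈ W.compatiblePi H p) (e : ℕ)
    (hSha : ∀ k, (p ^ e) • W.torsionToGeomH1Over ((p : ℤ) ^ k) H (x k) = 0) (k : ℕ) :
    ∃ P : W.fixedGeomPoints H, x k = W.kummerFamily p H P k := by
  obtain ⟨Q, hQ, hxQ⟩ := W.exists_kummerClassOver_eq_of_torsionToGeomH1Over_eq_zero _ H (x k)
    (W.torsionToGeomH1Over_apply_eq_zero_of_pow_smul_eq_zero p H hx e hSha k)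
  refine ⟨⟨((p : ℤ) ^ k) • Q, (W.mem_fixedGeomPoints_iff _).2 hQ⟩, ?_⟩
  rw [hxQ, W.isKummerFamilyOver_kummerFamily p H _ k Q rfl]

end Levelwise

/-! ## Part 3. `ℤ_p`-coordinates: compatible levelwise-Kummer families lie in the `ℤ_p`-span of the
Kummer families of generators (`E(L) ⊗ ℤ_p` in compact currency) -/

section PadicCoordinates

variable (p : ℕ) [Fact p.Prime]

/-- **`p`-adic interpolation of a compatible sequence of integers** (`ℤ_p = lim← ℤ/p^k`): if
`a_{k+1} ≡ a_k (mod p^k)` for all `k`, there is `c ∈ ℤ_p` with `c ≡ a_k (mod p^k)` for every `k`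
(Mathlib's universal property `PadicInt.lift`, applied to the evaluations `ℤ[X] → ℤ/p^k`, `X ↦ a_k`).
[cite: Serre1973, Ch. II §1 (`ℤ_p` as the projective limit of the `ℤ/p^nℤ`)] -/
theorem exists_padicInt_toZModPow_eq_intCast (a : ℕ → ℤ)
    (ha : ∀ k, a (k + 1) ≡ a k [ZMOD (p : ℤ) ^ k]) :
    ∃ c : ℤ_[p], ∀ k, PadicInt.toZModPow k c = (a k : ZMod (p ^ k)) := by
  have hmod : ∀ k j, a (k + j) ≡ a k [ZMOD (p : ℤ) ^ k] := by
    intro k j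
    induction j with
    | zero => exact Int.ModEq.refl _
    | succ j ih =>
      exact (Int.ModEq.of_dvd (pow_dvd_pow (p : ℤ) (Nat.le_add_right k j))
        (by rw [← add_assoc]; exact ha (k + j))).trans ih
  let f : ∀ k : ℕ, Polynomial ℤ →+* ZMod (p ^ k) := fun k ↦
    Polynomial.eval₂RingHom (Int.castRingHom (ZMod (p ^ k))) (a k : ZMod (p ^ k))
  have hf : ∀ (k1 k2 : ℕ) (hk : k1 ≤ k2),
      (ZMod.castHom (pow_dvd_pow p hk) (ZMod (p ^ k1))).comp (f k2) = f k1 := by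
    intro k1 k2 hk
    refine Polynomial.ringHom_ext (fun z ↦ ?_) ?_
    · rw [RingHom.comp_apply, Polynomial.coe_eval₂RingHom, Polynomial.coe_eval₂RingHom,
        Polynomial.eval₂_C, Polynomial.eval₂_C, eq_intCast, eq_intCast, map_intCast]
    rw [RingHom.comp_apply, Polynomial.coe_eval₂RingHom, Polynomial.coe_eval₂RingHom,
      Polynomial.eval₂_X, Polynomial.eval₂_X, map_intCast]
    obtain ⟨j, rfl⟩ := Nat.exists_eq_add_of_le hk
    rw [ZMod.intCast_eq_intCast_iff]
    push_cast
    exact hmod k1 j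
  refine ⟨PadicInt.lift hf Polynomial.X, fun k ↦ ?_⟩
  have h := congrArg (fun g : Polynomial ℤ →+* ZMod (p ^ k) ↦ g Polynomial.X) (PadicInt.lift_spec hf k)
  simp only [RingHom.comp_apply, f, Polynomial.coe_eval₂RingHom, Polynomial.eval₂_X] at h
  exact h

/-- The integer lift `[c]_k = (c mod p^k).val` of a `p`-adic integer `c` with `c ≡ a_k (mod p^k)` is
congruent to `a_k` modulo `p^k`. [cite: Serre1973, Ch. II §1 (`ℤ_p` as the projective limit of the `ℤ/p^nℤ`)] -/
theorem val_toZModPow_modEq_of_toZModPow_eq {c : ℤ_[p]} {k : ℕ} {a : ℤ}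
    (h : PadicInt.toZModPow k c = (a : ZMod (p ^ k))) :
    ((PadicInt.toZModPow k c).val : ℤ) ≡ a [ZMOD (p : ℤ) ^ k] := by
  have h1 : (((PadicInt.toZModPow k c).val : ℤ) : ZMod (p ^ k)) = (a : ZMod (p ^ k)) := by
    rw [Int.cast_natCast, ZMod.natCast_zmod_val, h]
  have h2 := (ZMod.intCast_eq_intCast_iff _ _ _).1 h1
  push_cast at h2
  exact h2

end PadicCoordinates

section Span

variable (p : ℕ) [Fact p.Prime] (H : Subgroup (Field.absoluteGaloisGroup K))

omit [Fact p.Prime] in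
/-- Unfolding the `ℤ_p`-action `padicPi` at level `k`: `(c · y)_k = [c]_k • y_k`, `[c]_k = (c mod p^k).val`.
[cite: PerrinRiou1987BSMF, §0 p. 401 (the `ℤ_p`-module structure of `S_p(L)`)] -/
theorem padicPi_apply [Fact p.Prime] (c : ℤ_[p]) (y : W.torsionH1Pi p H) (k : ℕ) :
    W.padicPi p H c y k = ((PadicInt.toZModPow k c).val : ℤ) • y k := by
  simp only [padicPi, AddMonoidHom.pi_apply, AddMonoidHom.coe_comp, Function.comp_apply,
    Pi.evalAddMonoidHom_apply, zsmulAddGroupHom_apply]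

/-- **A torsion point of `E(L)` is `p^k`-divisible in `E(L)` when `E(L)[p] = 0`**: its order `N` is then
prime to `p` (else `(N/p) • T` would be a non-zero `p`-torsion point of `E(L)`), and Bézout
`u N + v p^k = 1` gives `T = p^k • (v • T)`. [cite: SilvermanAEC2009, VIII.§2 (the Kummer map kills `mE(K)`; torsion prime to `m`)] -/
theorem exists_eq_pow_smul_of_isOfFinAddOrder
    (htors : ∀ T ∈ W.fixedGeomPoints H, (p : ℤ) • T = 0 → T = 0)
    {T : geomPoints W} (hT : T ∈ W.fixedGeomPoints H) (hfin : IsOfFinAddOrder T) (k : ℕ) :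
    ∃ T' ∈ W.fixedGeomPoints H, T = ((p : ℤ) ^ k) • T' := by
  have hp : p.Prime := Fact.out
  set N := addOrderOf T with hN
  have hNpos : 0 < N := hfin.addOrderOf_pos
  have hcop : Nat.Coprime N p := by
    rw [Nat.Coprime, Nat.gcd_comm, ← Nat.Coprime, hp.coprime_iff_not_dvd]
    rintro ⟨N', hN'⟩
    have hT1 : (p : ℤ) • ((N' : ℤ) • T) = 0 := by
      rw [smul_smul, ← Nat.cast_mul, ← hN', natCast_zsmul, hN, addOrderOf_nsmul_eq_zero]
    have h0 : (N' : ℤ) • T = 0 := htors _ (AddSubgroup.zsmul_mem _ hT _) hT1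
    rw [natCast_zsmul, ← addOrderOf_dvd_iff_nsmul_eq_zero, ← hN, hN'] at h0
    have hN'pos : 0 < N' := Nat.pos_of_ne_zero (by rintro rfl; simp [hN'] at hNpos)
    have := Nat.le_of_dvd hN'pos h0
    have h2 : 2 * N' ≤ p * N' := Nat.mul_le_mul_right _ hp.two_le
    omega
  obtain ⟨u, v, huv⟩ := (Nat.Coprime.pow_right k hcop).isCoprime
  refine ⟨v • T, AddSubgroup.zsmul_mem _ hT _, ?_⟩
  calc T = (1 : ℤ) • T := (one_smul ℤ T).symm
    _ = (u * (N : ℤ) + v * ((p : ℤ) ^ k)) • T := by rw [← huv]; push_cast; ring_nf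
    _ = ((p : ℤ) ^ k) • (v • T) := by
        rw [add_smul, mul_smul, natCast_zsmul, hN, addOrderOf_nsmul_eq_zero, smul_zero, zero_add,
          mul_comm, mul_smul]

variable {p H}

/-- **Compatible levelwise-Kummer families are `ℤ_p`-combinations of the Kummer families of generators**
(`E(L) ⊗ ℤ_p = lim← E(L)/p^k`, compact currency): `g_1, …, g_r` generate `E(L) = E(K̄)^H` modulo torsion
and are independent modulo torsion, `E(L)[p] = 0`; if `x` is compatible with `x_k = δ_k(P_k)`, `P_k ∈ E(L)`,
then `x = ∑ c_i · δ(g_i)`, `c_i ∈ ℤ_p` — so `x ∈ kummerSpan {g_i}`. (Coordinates `P_k = ∑ a^{(k)}_i g_i + T_k`;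
compatibility + Kummer injectivity give `P_{k+1} − P_k ∈ p^k E(L)`, so `a^{(k+1)} ≡ a^{(k)} (p^k)` by
independence; `c_i` interpolates; `x − ∑ c_i · δ(g_i)` is levelwise `δ_k` of a point of `p^k E(L)`, the
torsion parts being `p^k`-divisible.) Howard 2004, §1 / Perrin-Riou 1987, §0 (`E(L) ⊗ ℤ_p ↪ S_p(E/L)`).
[cite: Howard2004HeegnerKolyvagin, §1 (descent sequence for S_p(E/L))] -/
theorem mem_kummerSpan_range_of_forall_eq_kummerFamily_apply [W.IsElliptic] {r : ℕ}
    (g : Fin r → W.fixedGeomPoints H)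
    (hind : ∀ a : Fin r → ℤ, IsOfFinAddOrder (∑ i, a i • (g i : geomPoints W)) → a = 0)
    (hgen : ∀ R ∈ W.fixedGeomPoints H, ∃ (a : Fin r → ℤ) (T : geomPoints W),
      T ∈ W.fixedGeomPoints H ∧ IsOfFinAddOrder T ∧ R = (∑ i, a i • (g i : geomPoints W)) + T)
    (htors : ∀ T ∈ W.fixedGeomPoints H, (p : ℤ) • T = 0 → T = 0)
    {x : W.torsionH1Pi p H} (hx : x ∈ W.compatiblePi H p)
    (hK : ∀ k, ∃ P : W.fixedGeomPoints H, x k = W.kummerFamily p H P k) :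
    x ∈ W.kummerSpan p H (Set.range fun i ↦ (g i : geomPoints W))
      (fun P hP ↦ by obtain ⟨i, rfl⟩ := hP; exact (W.mem_fixedGeomPoints_iff _).1 (g i).2) := by
  classical
  choose P hP using hK
  choose a T hTfix hTfin hPa using fun k ↦ hgen (P k : geomPoints W) (P k).2
  have hstep : ∀ k i, a (k + 1) i ≡ a k i [ZMOD (p : ℤ) ^ k] := by
    intro k
    have hred : W.reduceTorsionH1 p k H (x (k + 1)) = x k := (W.mem_compatiblePi_iff.1 hx) k
    have he : W.kummerFamily p H (P (k + 1)) k = W.kummerFamily p H (P k) k := by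
      have h1 := (W.isKummerFamilyOver_kummerFamily p H (P (k + 1))).reduceTorsionH1 p k
      rw [← hP (k + 1), hred, hP k] at h1
      exact h1.symm
    have hk : W.kummerFamily p H (P (k + 1) - P k) k = 0 := by
      have h2 : W.kummerFamilyHom p H (P (k + 1) - P k) =
          W.kummerFamilyHom p H (P (k + 1)) - W.kummerFamilyHom p H (P k) := map_sub _ _ _
      rw [kummerFamilyHom_apply, kummerFamilyHom_apply, kummerFamilyHom_apply] at h2
      rw [h2, Pi.sub_apply, he, sub_self]
    obtain ⟨R, hR⟩ := (W.kummerFamily_apply_eq_zero_iff p H _ k).1 hk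
    obtain ⟨b, T', hT'fix, hT'fin, hRb⟩ := hgen (R : geomPoints W) R.2
    have hRc : ((p : ℤ) ^ k) • (R : geomPoints W) = (P (k + 1) : geomPoints W) - (P k : geomPoints W) := by
      rw [← AddSubgroupClass.coe_zsmul, hR, AddSubgroupClass.coe_sub]
    have hzero := hind (fun i ↦ a (k + 1) i - a k i - (p : ℤ) ^ k * b i) (by
      have heq : (∑ i, (a (k + 1) i - a k i - (p : ℤ) ^ k * b i) • (g i : geomPoints W)) =
          ((p : ℤ) ^ k) • T' + T k - T (k + 1) := by
        have h1 := hPa (k + 1)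
        have h2 := hPa k
        simp only [sub_smul, mul_smul, Finset.sum_sub_distrib, ← Finset.smul_sum]
        rw [hRb, smul_add] at hRc
        have e1 : (∑ i, a (k + 1) i • (g i : geomPoints W)) = (P (k + 1) : geomPoints W) - T (k + 1) :=
          eq_sub_of_add_eq h1.symm
        have e2 : (∑ i, a k i • (g i : geomPoints W)) = (P k : geomPoints W) - T k :=
          eq_sub_of_add_eq h2.symm
        have e3 : ((p : ℤ) ^ k) • (∑ i, b i • (g i : geomPoints W)) =
            (P (k + 1) : geomPoints W) - (P k : geomPoints W) - ((p : ℤ) ^ k) • T' :=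
          eq_sub_of_add_eq hRc
        rw [e1, e2, e3]
        abel
      rw [heq]
      exact ((AddCommGroup.mem_torsion _).1 (AddSubgroup.sub_mem _
        (AddSubgroup.add_mem _ (AddSubgroup.zsmul_mem _ ((AddCommGroup.mem_torsion _).2 hT'fin) _)
          ((AddCommGroup.mem_torsion _).2 (hTfin k)))
        ((AddCommGroup.mem_torsion _).2 (hTfin (k + 1))))))
    intro i
    have hi := congrFun hzero i
    simp only [Pi.zero_apply, sub_eq_zero] at hi
    exact (Int.modEq_iff_dvd.2 ⟨-b i, by rw [sub_eq_iff_eq_add.1 hi]; ring⟩)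
  choose c hc using fun i ↦ exists_padicInt_toZModPow_eq_intCast p (fun k ↦ a k i) (fun k ↦ hstep k i)
  have hS : ∀ Q ∈ Set.range (fun i ↦ (g i : geomPoints W)), ∀ σ ∈ H, σ • Q = Q := fun Q hQ ↦ by
    obtain ⟨i, rfl⟩ := hQ; exact (W.mem_fixedGeomPoints_iff _).1 (g i).2
  have hxy : x = ∑ i, W.padicPi p H (c i) (W.kummerFamily p H (g i)) := by
    funext k
    set n : Fin r → ℤ := fun i ↦ ((PadicInt.toZModPow k (c i)).val : ℤ) with hn
    have hnmod : ∀ i, n i ≡ a k i [ZMOD (p : ℤ) ^ k] := fun i ↦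
      val_toZModPow_modEq_of_toZModPow_eq p (hc i k)
    have hy : (∑ i, W.padicPi p H (c i) (W.kummerFamily p H (g i))) k =
        W.kummerFamily p H (∑ i, n i • g i) k := by
      rw [Finset.sum_apply, ← kummerFamilyHom_apply, map_sum, Finset.sum_apply]
      refine Finset.sum_congr rfl fun i _ ↦ ?_
      rw [padicPi_apply, map_zsmul, Pi.smul_apply, kummerFamilyHom_apply]
    rw [hy, hP k, ← sub_eq_zero, ← Pi.sub_apply]
    have h2 : W.kummerFamily p H (P k) - W.kummerFamily p H (∑ i, n i • g i) =
        W.kummerFamily p H (P k - ∑ i, n i • g i) := by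
      rw [← kummerFamilyHom_apply, ← kummerFamilyHom_apply, ← kummerFamilyHom_apply, map_sub]
    rw [h2, kummerFamily_apply_eq_zero_iff]
    choose m hm using fun i ↦ Int.modEq_iff_dvd.1 (hnmod i)
    obtain ⟨T'', hT''fix, hT''⟩ := W.exists_eq_pow_smul_of_isOfFinAddOrder p H htors (hTfix k) (hTfin k) k
    refine ⟨⟨(∑ i, m i • (g i : geomPoints W)) + T'', AddSubgroup.add_mem _
      (AddSubgroup.sum_mem _ fun i _ ↦ AddSubgroup.zsmul_mem _ (g i).2 _) hT''fix⟩, Subtype.ext ?_⟩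
    rw [AddSubgroupClass.coe_zsmul, AddSubgroupClass.coe_sub, AddSubmonoidClass.coe_finsetSum, hPa k,
      hT'', smul_add, Finset.smul_sum]
    simp only [AddSubgroupClass.coe_zsmul, smul_smul]
    have : ∀ i, (p : ℤ) ^ k * m i = a k i - n i := fun i ↦ (hm i).symm
    simp only [this, sub_smul, Finset.sum_sub_distrib]
    abel
  rw [hxy]
  exact AddSubgroup.sum_mem _ fun i _ ↦
    W.padicPi_mem_kummerSpan p H hS ⟨i, rfl⟩ (c i) (W.isKummerFamilyOver_kummerFamily p H (g i))

/-- **The compact Kummer descent** (Parts 2 + 3). `L = K̄^H`, `E(L)` generated modulo torsion by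
`g_1, …, g_r` (independent modulo torsion), `E(L)[p] = 0`: every compatible family `x ∈ ∏_k H¹(H, E[p^k])`
whose images in `H¹(H, E(K̄))` are killed by one power `p^e` — for SELMER families: whenever the part of
`Ш(E/L)[p^∞]` they reach has exponent `p^e`, e.g. `Ш(E/L)[p^∞]` finite — lies in
`E(L) ⊗ ℤ_p = mordellWeilKummerSpan`: the `E(L) ⊗ ℤ_p`-half of `0 → E(L) ⊗ ℤ_p → S_p(E/L) → T_pШ(E/L) → 0`
in compact currency (the (S_sat-MW) half of the cell's `RamifiedCMBottomSaturationAt`).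
[cite: Howard2004HeegnerKolyvagin, §1 (descent sequence for S_p(E/L))]
[cite: PerrinRiou1987BSMF, §0 pp. 401–402 (`E(L) ⊗ ℤ_p ↪ S_p(L)`)] -/
theorem mem_mordellWeilKummerSpan_of_pow_smul_torsionToGeomH1Over_eq_zero [W.IsElliptic] {r : ℕ}
    (g : Fin r → W.fixedGeomPoints H)
    (hind : ∀ a : Fin r → ℤ, IsOfFinAddOrder (∑ i, a i • (g i : geomPoints W)) → a = 0)
    (hgen : ∀ R ∈ W.fixedGeomPoints H, ∃ (a : Fin r → ℤ) (T : geomPoints W),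
      T ∈ W.fixedGeomPoints H ∧ IsOfFinAddOrder T ∧ R = (∑ i, a i • (g i : geomPoints W)) + T)
    (htors : ∀ T ∈ W.fixedGeomPoints H, (p : ℤ) • T = 0 → T = 0)
    {x : W.torsionH1Pi p H} (hx : x ∈ W.compatiblePi H p) (e : ℕ)
    (hSha : ∀ k, (p ^ e) • W.torsionToGeomH1Over ((p : ℤ) ^ k) H (x k) = 0) :
    x ∈ W.mordellWeilKummerSpan p H :=
  W.kummerSpan_mono p H _ (by rintro _ ⟨i, rfl⟩; exact (g i).2)
    (W.mem_kummerSpan_range_of_forall_eq_kummerFamily_apply g hind hgen htors hx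
      (W.exists_kummerFamily_apply_eq_of_pow_smul_eq_zero p H hx e hSha))

end Span

end WeierstrassCurve

end
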